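import Mathlib
import Literature.Computability.Complexity.RangeAvoidance
import Summits.PneNP.PneNP.Theorems.PstarPairwise
import Summits.PneNP.PneNP.Theorems.PairwiseSALevel
import Summits.PneNP.PneNP.Theorems.QuotientSABlocks
import Summits.PneNP.PneNP.Theorems.PstarIP3Law
import Summits.PneNP.PneNP.Theorems.AffineAndLaws
import Summits.PneNP.PneNP.Theorems.AffineAndLawsMarginals
import Summits.PneNP.PneNP.Theorems.QuotientSACutCoset

/-!
# T22.1a(ii) `BlockLaws`: the block laws of the `K_t`-block construction are pairwise independent (cell `pnp-ideate`, ROUND-22)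

FRONTIER range-avoidance ladder, rung F-N3 context (restricted-model lower bounds; nothing here bears on `P` vs `NP`).
Closes the target `QuotientSABlocks.BlockLaws` BY NAME (`blockLaws`): for every block system `A`, quotient target `b` and
block `β`, the law on the `K = (s+1)s` slots of block `β` is the `1/√2`-biased product law conditioned on the AND-vector of
the `#E` edge pairs lying in the pattern set `patSet (b ∘ triIdx β)` (a coset of `Cut(K_{s+1})`), i.e.
`AffineAndLaws.andLaw (√2/2) (patSet _)` transported along the slot bijection `slotPairs s : Fin K ≃ Fin (#E + #E)` (slot
`(v,w)`, `v<w`, ↦ first slot of the pair of edge `{v,w}`; `(w,v)` ↦ second slot).  Mass `1`, marginals `ρ_{1/√2}` and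
pairwise independence are `AffineAndLawsMarginals.andLaw_total / marg1_andLaw / marg2_andLaw` fed with
`QuotientSACutCoset.patSet_nonempty / unif1_patSet / unif2_patSet`; the support clause is `blk_table_iff`.
With `PairwiseSA.pairwiseSALinearLevel` (T22.0 hub), `QuotientSABlockRange.blockRange` (B2) and `BlockExpandExist` (B3, open)
this feeds `QuotientSABlocks.saAfterQuotientBlind_of` (HEADLINE-22).
-/

set_option linter.dupNamespace false

open Finset
open Literature.Computability.Complexity
open Summit.PneNP.PneNP.Theorems.PstarPairwise (rho)
open Summit.PneNP.PneNP.Theorems.PairwiseSALevel (marg1 marg2 PairwiseLaws)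
open Summit.PneNP.PneNP.Theorems.QuotientSABlocks
open Summit.PneNP.PneNP.Theorems.PstarIP3Law (rhalf_spec)
open Summit.PneNP.PneNP.Theorems.AffineAndLaws
open Summit.PneNP.PneNP.Theorems.AffineAndLawsMarginals
open Summit.PneNP.PneNP.Theorems.QuotientSACutCoset

namespace Summit.PneNP.PneNP.Theorems.QuotientSABlockLaws

/-! ## Transport of weights along a slot bijection -/

section transport

variable {K K' : ℕ} (σ : Fin K ≃ Fin K')

/-- Total mass is invariant under transport. -/
theorem sum_transport (w : (Fin K' → Bool) → ℝ) :
    ∑ u : Fin K → Bool, w (fun t => u (σ.symm t)) = ∑ u', w u' :=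
  Fintype.sum_equiv (σ.arrowCongr (Equiv.refl Bool)) _ _ fun _ => rfl

/-- One-slot marginals under transport. -/
theorem marg1_transport (w : (Fin K' → Bool) → ℝ) (k : Fin K) (α : Bool) :
    marg1 (fun u : Fin K → Bool => w fun t => u (σ.symm t)) k α = marg1 w (σ k) α := by
  unfold PairwiseSALevel.marg1
  refine Fintype.sum_equiv (σ.arrowCongr (Equiv.refl Bool)) _ _ fun u => ?_
  have h1 : (σ.arrowCongr (Equiv.refl Bool)) u = fun t => u (σ.symm t) := rfl
  rw [h1]
  simp only [Equiv.symm_apply_apply]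

/-- Two-slot marginals under transport. -/
theorem marg2_transport (w : (Fin K' → Bool) → ℝ) (k k' : Fin K) (α β : Bool) :
    marg2 (fun u : Fin K → Bool => w fun t => u (σ.symm t)) k k' α β = marg2 w (σ k) (σ k') α β := by
  unfold PairwiseSALevel.marg2
  refine Fintype.sum_equiv (σ.arrowCongr (Equiv.refl Bool)) _ _ fun u => ?_
  have h1 : (σ.arrowCongr (Equiv.refl Bool)) u = fun t => u (σ.symm t) := rfl
  rw [h1]
  simp only [Equiv.symm_apply_apply]

end transport

/-- Total mass of `andLaw` in the degenerate case `E = 0` (no pairs: the law is the point mass). -/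
theorem andLaw_total_zero {E : ℕ} (hE : E = 0) (r : ℝ) (A : Finset (Fin E → Bool)) (hA : A.Nonempty) :
    ∑ u : Fin (E + E) → Bool, andLaw r A u = 1 := by
  subst hE
  have huniq : (Finset.univ : Finset (Fin (0 + 0) → Bool)) = {fun i => Fin.elim0 i} := by
    ext u
    simp only [Finset.mem_univ, Finset.mem_singleton, true_iff]
    exact funext fun i => Fin.elim0 i
  rw [huniq, Finset.sum_singleton]
  unfold andLaw
  have hmem : andVec (fun i : Fin (0 + 0) => (Fin.elim0 i : Bool)) ∈ A := by
    obtain ⟨a, ha⟩ := hA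
    have : andVec (fun i : Fin (0 + 0) => (Fin.elim0 i : Bool)) = a := funext fun i => Fin.elim0 i
    rw [this]
    exact ha
  have hcard : A.card = 1 := by
    apply le_antisymm
    · calc A.card ≤ (Finset.univ : Finset (Fin 0 → Bool)).card := Finset.card_le_univ _
        _ = 1 := by simp
    · exact hA.card_pos
  rw [if_pos hmem, hcard]
  simp [wprod]

/-! ## The slot bijection `Fin K ≃ Fin (#E + #E)` -/

variable {s nb n' : ℕ}

/-- Slots `(v, w)` of a block split as forward (`v < w`) and backward (`w < v`) copies of the edges. -/
def slotSum (s : ℕ) : Slot s ≃ (Edge s ⊕ Edge s) where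
  toFun p := if h : p.1.1 < p.1.2 then Sum.inl ⟨p.1, h⟩
    else Sum.inr ⟨(p.1.2, p.1.1), lt_of_le_of_ne (not_lt.1 h) p.2.symm⟩
  invFun := Sum.elim (fun e => ⟨e.1, ne_of_lt e.2⟩) (fun e => ⟨(e.1.2, e.1.1), (ne_of_lt e.2).symm⟩)
  left_inv p := by
    by_cases h : p.1.1 < p.1.2
    · simp only [h, dite_true, Sum.elim_inl]
    · simp only [h, dite_false, Sum.elim_inr]
  right_inv x := by
    rcases x with e | e
    · simp only [Sum.elim_inl, e.2, dite_true]
    · have h : ¬ e.1.2 < e.1.1 := not_lt.2 (le_of_lt e.2)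
      simp only [Sum.elim_inr, h, dite_false]

/-- **The slot bijection**: slot `(v,w)` with `v<w` ↦ first slot `castAdd (eEdge {v,w})` of the pair of its edge,
`(w,v)` ↦ second slot `natAdd (eEdge {v,w})`. -/
noncomputable def slotPairs (s : ℕ) : Fin (kBlk s) ≃ Fin (nE s + nE s) :=
  (eSlot s).symm.trans ((slotSum s).trans (((eEdge s).sumCongr (eEdge s)).trans finSumFinEquiv))

/-- The first slot of pair `i` is the forward slot of edge `i`. -/
theorem slotPairs_symm_castAdd (i : Fin (nE s)) :
    (slotPairs s).symm (Fin.castAdd (nE s) i) = eSlot s ⟨((eEdge s).symm i).1, ne_of_lt ((eEdge s).symm i).2⟩ := by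
  simp only [slotPairs, Equiv.symm_trans_apply, Equiv.symm_symm, finSumFinEquiv_symm_apply_castAdd,
    Equiv.sumCongr_symm, Equiv.sumCongr_apply, Sum.map_inl]
  rfl

/-- The second slot of pair `i` is the backward slot of edge `i`. -/
theorem slotPairs_symm_natAdd (i : Fin (nE s)) :
    (slotPairs s).symm (Fin.natAdd (nE s) i) =
      eSlot s ⟨(((eEdge s).symm i).1.2, ((eEdge s).symm i).1.1), (ne_of_lt ((eEdge s).symm i).2).symm⟩ := by
  simp only [slotPairs, Equiv.symm_trans_apply, Equiv.symm_symm, finSumFinEquiv_symm_apply_natAdd,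
    Equiv.sumCongr_symm, Equiv.sumCongr_apply, Sum.map_inr]
  rfl

/-- The AND-bit of pair `e` of a transported slot assignment is the AND of the two slots of edge `e`. -/
theorem andVec_slotPairs (u : Fin (kBlk s) → Bool) (e : Edge s) :
    andVec (fun t => u ((slotPairs s).symm t)) (eEdge s e) =
      (u (eSlot s ⟨e.1, ne_of_lt e.2⟩) && u (eSlot s ⟨(e.1.2, e.1.1), (ne_of_lt e.2).symm⟩)) := by
  simp only [andVec, slotPairs_symm_castAdd, slotPairs_symm_natAdd, Equiv.symm_apply_apply]

/-- The apex parities of the block map are the apex parities of the AND-vector of the transported assignment. -/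
theorem triVal_eq_triXor (u : Fin (kBlk s) → Bool) (τ : Tri s) :
    triVal (fun p => u (eSlot s p)) τ = triXor (andVec fun t => u ((slotPairs s).symm t)) τ := by
  simp only [triVal, triXor, andVec_slotPairs, triSlot, triEdge₁, triEdge₂, triEdge₃, Matrix.cons_val_zero,
    Matrix.cons_val_one]
  rfl

/-- **Support clause**: block `β` accepts `u` iff the AND-vector of the transported assignment lies in the pattern set of
the parities `b (triIdx β ·)`. -/
theorem blk_table_iff (A : BlockSys s nb n') (b : Fin (βOut s nb) → Bool) (β : Fin nb) (u : Fin (kBlk s) → Bool) :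
    (blk A b).table β u = true ↔ andVec (fun t => u ((slotPairs s).symm t)) ∈ patSet (fun τ => b (triIdx β τ)) := by
  rw [mem_patSet]
  show decide _ = true ↔ _
  rw [decide_eq_true_iff]
  simp only [triVal_eq_triXor]

/-! ## The block laws -/

/-- **The block laws are pairwise laws** for `blk A b` at the all-true target: constant bias `√2/2`, law of block `β` =
`andLaw (√2/2) (patSet (b ∘ triIdx β))` transported along `slotPairs`. -/
theorem pairwiseLaws_blk (A : BlockSys s nb n') (b : Fin (βOut s nb) → Bool) :
    PairwiseLaws (blk A b) (fun _ => true) (fun _ => Real.sqrt 2 / 2)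
      (fun β u => andLaw (Real.sqrt 2 / 2) (patSet fun τ => b (triIdx β τ)) fun t => u ((slotPairs s).symm t)) := by
  obtain ⟨hr, h0, h1⟩ := rhalf_spec
  have hU1 : ∀ (c : Tri s → Bool) (e : Fin (nE s)), Unif1 (patSet c) e := fun c e => unif1_patSet c e
  have hU2 : ∀ (c : Tri s → Bool) (e e' : Fin (nE s)), e ≠ e' → Unif2 (patSet c) e e' :=
    fun c e e' h => unif2_patSet c h
  refine ⟨fun _ => h0, fun _ => h1, fun β u => andLaw_nonneg h0.le h1.le _ _, fun β => ?_, fun β u hu => ?_,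
    fun β k α => ?_, fun β k k' hkk α α' => ?_⟩
  · show ∑ u : Fin (kBlk s) → Bool,
        andLaw (Real.sqrt 2 / 2) (patSet fun τ => b (triIdx β τ)) (fun t => u ((slotPairs s).symm t)) = 1
    rw [sum_transport (slotPairs s) (andLaw (Real.sqrt 2 / 2) (patSet fun τ => b (triIdx β τ)))]
    rcases Nat.eq_zero_or_pos (nE s) with hE | hE
    · exact andLaw_total_zero hE _ _ (patSet_nonempty _)
    · exact andLaw_total hr _ (patSet_nonempty _) hE (hU1 _)
  · show (blk A b).table β u = true
    rw [blk_table_iff]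
    exact andLaw_support _ _ _ hu
  · show marg1 (fun u : Fin (kBlk s) → Bool =>
        andLaw (Real.sqrt 2 / 2) (patSet fun τ => b (triIdx β τ)) fun t => u ((slotPairs s).symm t)) k α =
        rho (Real.sqrt 2 / 2) α
    rw [marg1_transport]
    exact marg1_andLaw hr _ (patSet_nonempty _) (hU1 _) _ _
  · show marg2 (fun u : Fin (kBlk s) → Bool =>
        andLaw (Real.sqrt 2 / 2) (patSet fun τ => b (triIdx β τ)) fun t => u ((slotPairs s).symm t)) k k' α α' =
        marg1 (fun u : Fin (kBlk s) → Bool =>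
          andLaw (Real.sqrt 2 / 2) (patSet fun τ => b (triIdx β τ)) fun t => u ((slotPairs s).symm t)) k α *
        marg1 (fun u : Fin (kBlk s) → Bool =>
          andLaw (Real.sqrt 2 / 2) (patSet fun τ => b (triIdx β τ)) fun t => u ((slotPairs s).symm t)) k' α'
    rw [marg2_transport, marg1_transport, marg1_transport, marg1_andLaw hr _ (patSet_nonempty _) (hU1 _),
      marg1_andLaw hr _ (patSet_nonempty _) (hU1 _)]
    exact marg2_andLaw hr _ (patSet_nonempty _) (hU1 _) (hU2 _) _ _ (fun h => hkk ((slotPairs s).injective h)) _ _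

/-- **T22.1a(ii): `BlockLaws` holds** (closes `QuotientSABlocks.BlockLaws` by name). -/
theorem blockLaws : BlockLaws := fun _ _ _ A b => ⟨_, _, pairwiseLaws_blk A b⟩

end Summit.PneNP.PneNP.Theorems.QuotientSABlockLaws
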